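import Literature.NumberTheory.ModularForms.PoincareSeriesWeightTwoHeckeAssembly
import Literature.NumberTheory.ModularForms.PoincareSeriesWeightTwoL2OfDominated
import Literature.NumberTheory.ModularForms.PoincareSeriesWeightTwoHeckeSqIntegrable
import Literature.NumberTheory.ModularForms.PoincareSeriesWeightTwoHeckeLimit
import Literature.NumberTheory.ModularForms.PoincareSeriesWeightTwoFourierModes
import Literature.NumberTheory.ModularForms.PoincareSeriesWeightTwoQSeriesHolomorphic
import Mathlib.MeasureTheory.Integral.Lebesgue.Add
import Mathlib.Analysis.Complex.UpperHalfPlane.Manifold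
import HarnessLib

/-!
# Hecke's limit in the weight-2 Petersson norm from an `L²`-Cauchy family (Fatou), and from the
# Gram limit

Topic `Literature/NumberTheory/ModularForms` (namespace `Literature.NumberTheory.ModularForms.PoincareWeightTwo`,
continuing `PoincareSeriesWeightTwoHecke.lean`). THEOREMS ONLY; no definition, no named fact. The
measure-theoretic end of the GRAM ROUTE to conjuncts (a) and (c) of `HeckeL2` of the I1 fact skeleton
`Summits/Parity/GeneralizedHardyLittlewood/Cruxes/PeterssonBoundPrinted/Lines/poincare_hecke.lean`
(crux item stmt-Parity-20404; Iwaniec–Kowalski §14.1–§14.2 with Hecke's trick §3.2, Selberg's `L²`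
form): for a family `E s : ℍ → ℂ` (`0 < s ≤ 1`) of continuous functions, square-integrable for the
Petersson pairing of level `Γ₀(N)` and weight `2` (`PeterssonSqIntegrable N 2`), converging pointwise
to a continuous `Q` as `s → 0⁺`,

* `lintegral_sqIntegrand_sub_le_of_cauchy` — **Fatou against the pointwise limit**: if
  `Re⟨E s − E s', E s − E s'⟩ ≤ ε` for all `s' ∈ (0, δ)`, then `∫⁻_𝒟 Σ_q |E s − Q|²(q⁻¹τ) Im² ≤ ε`
  (Mathlib `lintegral_liminf_le'` along the countably generated filter `𝓝[>] 0`);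
* `heckeL2_of_cauchy` — if the family is CAUCHY, `Re⟨E s − E s', E s − E s'⟩ → 0` as
  `(s, s') → (0⁺, 0⁺)`, then `Q` is square-integrable and `Re⟨E s − Q, E s − Q⟩ → 0` ((a) and (c));
* `re_peterssonPairing_sub_sub` — `Re⟨g − h, g − h⟩ = Re⟨g,g⟩ − Re⟨g,h⟩ − Re⟨h,g⟩ + Re⟨h,h⟩` for
  measurable square-integrable `g, h` (with `peterssonPairing_sub_right`);
* `heckeL2_of_gram_limit` — the same conclusion from the **Gram limit**: if the pairings `⟨E s, E s'⟩`
  converge (to anything) as `(s, s') → (0⁺, 0⁺)`, the family is Cauchy;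
* `heckeL2_at_of_gram_limit` — the CONCRETE instance: for `E s = yˢP_m(·,s)` (continuous by
  `continuous_rpow_im_mul_poincareHecke`, square-integrable by `peterssonSqIntegrable_rpow_im_mul_poincareHecke`,
  pointwise limit `Q = poincareQSeries N m` by `heckeLimit_of_fourierModes heckeFourierModes` and
  `yˢ → 1`, `Q` continuous by `mdifferentiable_poincareQSeries`), the Gram limit of `⟨E s, E s'⟩` on
  `(𝓝[>] 0) ×ˢ (𝓝[>] 0)` ALONE gives the three conjuncts of `HeckeL2` at `(N, m)`.

So the Gram limit (unfolding `PoincareSeriesWeightTwoHeckeUnfoldingGeneral` + the `m`-th Fourier mode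
near `y → 0`) is all that is left of `HeckeL2`.

## References

* [IwaniecKowalski2004] H. Iwaniec, E. Kowalski, *Analytic Number Theory*, AMS Colloq. Publ. 53,
  §14.1 (14.11), §14.2 (Lemma 14.2 at k = 2), §3.2 (Hecke's trick).

## Mathlib / tree search

Tree: `continuous_sqIntegrand`, `peterssonSqIntegrable_of_le` (`…L2OfDominated`),
`integrableOn_sum_petersson`, `peterssonPairing_sub_left`, `peterssonSqIntegrable_sub` (`…HeckeAssembly`),
`peterssonPairing_self_re` (`…PeterssonPairingCS`), `continuous_rpow_im_mul_poincareHecke`,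
`peterssonSqIntegrable_rpow_im_mul_poincareHecke`, `heckeLimit_of_fourierModes`, `heckeFourierModes`,
`mdifferentiable_poincareQSeries`; Mathlib `MeasureTheory.lintegral_liminf_le'`,
`Filter.liminf_le_of_frequently_le'`, `nhdsGT_basis`, `Filter.HasBasis.prod_self`.
-/

noncomputable section

open scoped MatrixGroups Real Topology ENNReal Manifold
open CongruenceSubgroup Complex MeasureTheory Filter
open UpperHalfPlane hiding I

namespace Literature.NumberTheory.ModularForms.PoincareWeightTwo

variable {N : ℕ} [NeZero N]

/-! ### Algebra of the pairing -/

/-- **Additivity of the Petersson pairing in the second slot** (on integrable integrands):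
`⟨g₁, g₂ − g₂'⟩ = ⟨g₁, g₂⟩ − ⟨g₁, g₂'⟩`. [cite: IwaniecKowalski2004, (14.11)] -/
theorem peterssonPairing_sub_right {k : ℤ} (g₁ g₂ g₂' : ℍ → ℂ)
    (h₂ : letI := Fintype.ofFinite (𝒮ℒ ⧸ (Gamma0 N : Subgroup (GL (Fin 2) ℝ)).subgroupOf 𝒮ℒ)
      IntegrableOn (fun τ : ℍ ↦ ∑ q : 𝒮ℒ ⧸ (Gamma0 N : Subgroup (GL (Fin 2) ℝ)).subgroupOf 𝒮ℒ,
        petersson k g₁ g₂ (((q.out : 𝒮ℒ) : GL (Fin 2) ℝ)⁻¹ • τ)) ModularGroup.fd volume)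
    (h₂' : letI := Fintype.ofFinite (𝒮ℒ ⧸ (Gamma0 N : Subgroup (GL (Fin 2) ℝ)).subgroupOf 𝒮ℒ)
      IntegrableOn (fun τ : ℍ ↦ ∑ q : 𝒮ℒ ⧸ (Gamma0 N : Subgroup (GL (Fin 2) ℝ)).subgroupOf 𝒮ℒ,
        petersson k g₁ g₂' (((q.out : 𝒮ℒ) : GL (Fin 2) ℝ)⁻¹ • τ)) ModularGroup.fd volume) :
    peterssonPairing N k g₁ (fun z ↦ g₂ z - g₂' z) =
      peterssonPairing N k g₁ g₂ - peterssonPairing N k g₁ g₂' := by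
  letI := Fintype.ofFinite (𝒮ℒ ⧸ (Gamma0 N : Subgroup (GL (Fin 2) ℝ)).subgroupOf 𝒮ℒ)
  unfold peterssonPairing
  rw [← integral_sub h₂ h₂']
  refine setIntegral_congr_fun ModularGroup.isClosed_fd.measurableSet fun τ _ ↦ ?_
  rw [← Finset.sum_sub_distrib]
  refine Finset.sum_congr rfl fun q _ ↦ ?_
  simp only [petersson]
  ring

/-- **`Re⟨g − h, g − h⟩ = Re⟨g,g⟩ − Re⟨g,h⟩ − Re⟨h,g⟩ + Re⟨h,h⟩`** for measurable square-integrable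
`g, h` (all four integrands are integrable, `integrableOn_sum_petersson`). [cite: IwaniecKowalski2004, (14.11)] -/
theorem re_peterssonPairing_sub_sub (g h : ℍ → ℂ) (hg : Measurable g) (hh : Measurable h)
    (hgi : PeterssonSqIntegrable N 2 g) (hhi : PeterssonSqIntegrable N 2 h) :
    (peterssonPairing N 2 (fun z ↦ g z - h z) (fun z ↦ g z - h z)).re =
      (peterssonPairing N 2 g g).re - (peterssonPairing N 2 g h).re -
        (peterssonPairing N 2 h g).re + (peterssonPairing N 2 h h).re := by
  have hd : Measurable (fun z ↦ g z - h z) := hg.sub hh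
  have hdi : PeterssonSqIntegrable N 2 (fun z ↦ g z - h z) := peterssonSqIntegrable_sub g h hg hh hgi hhi
  rw [peterssonPairing_sub_left g h (fun z ↦ g z - h z)
      (integrableOn_sum_petersson g _ hg hd hgi hdi) (integrableOn_sum_petersson h _ hh hd hhi hdi),
    peterssonPairing_sub_right g g h (integrableOn_sum_petersson g g hg hg hgi hgi)
      (integrableOn_sum_petersson g h hg hh hgi hhi),
    peterssonPairing_sub_right h g h (integrableOn_sum_petersson h g hh hg hhi hgi)
      (integrableOn_sum_petersson h h hh hh hhi hhi)]
  simp only [Complex.sub_re]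
  ring

/-- `Re⟨g, g⟩ ≥ 0` (it is the integral of the non-negative square-integrand over `𝒟`).
[cite: IwaniecKowalski2004, (14.11)] -/
theorem re_peterssonPairing_self_nonneg (g : ℍ → ℂ) : 0 ≤ (peterssonPairing N 2 g g).re := by
  letI := Fintype.ofFinite (𝒮ℒ ⧸ (Gamma0 N : Subgroup (GL (Fin 2) ℝ)).subgroupOf 𝒮ℒ)
  rw [peterssonPairing_self_re]
  exact setIntegral_nonneg ModularGroup.isClosed_fd.measurableSet fun τ _ ↦
    Finset.sum_nonneg fun q _ ↦ mul_nonneg (sq_nonneg _) (zpow_pos (UpperHalfPlane.im_pos _) _).le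

/-! ### Fatou against the pointwise limit -/

/-- **Fatou against the pointwise limit.** Let `E s → Q` pointwise as `s → 0⁺` (continuous, the `E s`
square-integrable for `0 < s ≤ 1`). If for some `0 < s ≤ 1` the distances `Re⟨E s − E s', E s − E s'⟩`
are `≤ ε` for all `s' ∈ (0, δ)`, then `∫⁻_𝒟 Σ_q |(E s − Q)(q⁻¹τ)|² (Im q⁻¹τ)² ≤ ε`.
[cite: IwaniecKowalski2004, §14.2 (k = 2, Hecke's trick §3.2)] -/
theorem lintegral_sqIntegrand_sub_le_of_cauchy (E : ℝ → ℍ → ℂ) (Q : ℍ → ℂ)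
    (hE : ∀ s : ℝ, 0 < s → s ≤ 1 → Continuous (E s))
    (hEint : ∀ s : ℝ, 0 < s → s ≤ 1 → PeterssonSqIntegrable N 2 (E s))
    (hlim : ∀ z : ℍ, Tendsto (fun s : ℝ ↦ E s z) (𝓝[>] 0) (𝓝 (Q z)))
    {s ε δ : ℝ} (hs : 0 < s) (hs1 : s ≤ 1) (hδ : 0 < δ)
    (hεδ : ∀ s' : ℝ, 0 < s' → s' < δ →
      (peterssonPairing N 2 (fun z ↦ E s z - E s' z) (fun z ↦ E s z - E s' z)).re ≤ ε) :
    letI := Fintype.ofFinite (𝒮ℒ ⧸ (Gamma0 N : Subgroup (GL (Fin 2) ℝ)).subgroupOf 𝒮ℒ)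
    ∫⁻ τ in ModularGroup.fd, ENNReal.ofReal
        (∑ q : 𝒮ℒ ⧸ (Gamma0 N : Subgroup (GL (Fin 2) ℝ)).subgroupOf 𝒮ℒ,
          ‖E s (((q.out : 𝒮ℒ) : GL (Fin 2) ℝ)⁻¹ • τ) - Q (((q.out : 𝒮ℒ) : GL (Fin 2) ℝ)⁻¹ • τ)‖ ^ 2 *
            ((((q.out : 𝒮ℒ) : GL (Fin 2) ℝ)⁻¹ • τ).im) ^ (2 : ℤ)) ≤ ENNReal.ofReal ε := by
  letI := Fintype.ofFinite (𝒮ℒ ⧸ (Gamma0 N : Subgroup (GL (Fin 2) ℝ)).subgroupOf 𝒮ℒ)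
  set w : (𝒮ℒ ⧸ (Gamma0 N : Subgroup (GL (Fin 2) ℝ)).subgroupOf 𝒮ℒ) → ℍ → ℍ :=
    fun q τ ↦ (((q.out : 𝒮ℒ) : GL (Fin 2) ℝ)⁻¹ • τ : ℍ) with hw
  -- the square-integrands of `E s − E s'` (for `s' ∈ (0,1]`, else `0`) and of `E s − Q`
  set D : ℝ → ℍ → ℝ≥0∞ := fun s' τ ↦ if 0 < s' ∧ s' ≤ 1 then
      ENNReal.ofReal (∑ q, ‖E s (w q τ) - E s' (w q τ)‖ ^ 2 * ((w q τ).im) ^ (2 : ℤ)) else 0 with hD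
  set S : ℍ → ℝ≥0∞ := fun τ ↦
    ENNReal.ofReal (∑ q, ‖E s (w q τ) - Q (w q τ)‖ ^ 2 * ((w q τ).im) ^ (2 : ℤ)) with hS
  change ∫⁻ τ in ModularGroup.fd, S τ ≤ ENNReal.ofReal ε
  -- measurability of each `D s'`
  have hDmeas : ∀ s' : ℝ, Measurable (D s') := by
    intro s'
    by_cases h : 0 < s' ∧ s' ≤ 1
    · simp only [hD, if_pos h]
      exact ENNReal.measurable_ofReal.comp
        (continuous_sqIntegrand ((hE s hs hs1).sub (hE s' h.1 h.2))).measurable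
    · simp only [hD, if_neg h]
      exact measurable_const
  -- the pointwise limit `D s' τ → S τ` as `s' → 0⁺`
  have hDlim : ∀ τ : ℍ, Tendsto (fun s' : ℝ ↦ D s' τ) (𝓝[>] 0) (𝓝 (S τ)) := by
    intro τ
    have h1 : Tendsto (fun s' : ℝ ↦
        ENNReal.ofReal (∑ q, ‖E s (w q τ) - E s' (w q τ)‖ ^ 2 * ((w q τ).im) ^ (2 : ℤ)))
        (𝓝[>] 0) (𝓝 (S τ)) := by
      refine ENNReal.tendsto_ofReal (tendsto_finsetSum _ fun q _ ↦ ?_)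
      exact ((continuous_norm.continuousAt.tendsto.comp
        (((hlim (w q τ)).const_sub (E s (w q τ))))).pow 2).mul_const _
    refine h1.congr' ?_
    filter_upwards [Ioc_mem_nhdsGT (show (0 : ℝ) < 1 by norm_num)] with s' hs'
    simp only [hD, if_pos (show 0 < s' ∧ s' ≤ 1 from ⟨hs'.1, hs'.2⟩)]
  -- Fatou
  have hF : ∫⁻ τ in ModularGroup.fd, S τ ≤
      liminf (fun s' : ℝ ↦ ∫⁻ τ in ModularGroup.fd, D s' τ) (𝓝[>] 0) := by
    calc ∫⁻ τ in ModularGroup.fd, S τ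
        = ∫⁻ τ in ModularGroup.fd, liminf (fun s' : ℝ ↦ D s' τ) (𝓝[>] 0) :=
          lintegral_congr fun τ ↦ ((hDlim τ).liminf_eq).symm
      _ ≤ liminf (fun s' : ℝ ↦ ∫⁻ τ in ModularGroup.fd, D s' τ) (𝓝[>] 0) :=
          lintegral_liminf_le' fun s' ↦ (hDmeas s').aemeasurable
  refine hF.trans (liminf_le_of_frequently_le' (Filter.Eventually.frequently ?_))
  -- eventually (`s' ∈ (0, min δ 1)`): `∫⁻ D s' = ofReal Re⟨E s − E s', E s − E s'⟩ ≤ ofReal ε`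
  filter_upwards [Ioo_mem_nhdsGT (lt_min hδ one_pos)] with s' hs'
  have hs'0 : 0 < s' := hs'.1
  have hs'δ : s' < δ := lt_of_lt_of_le hs'.2 (min_le_left _ _)
  have hs'1 : s' ≤ 1 := (lt_of_lt_of_le hs'.2 (min_le_right _ _)).le
  have hint : PeterssonSqIntegrable N 2 (fun z ↦ E s z - E s' z) :=
    peterssonSqIntegrable_sub _ _ (hE s hs hs1).measurable (hE s' hs'0 hs'1).measurable
      (hEint s hs hs1) (hEint s' hs'0 hs'1)
  have hint' : IntegrableOn (fun τ : ℍ ↦ ∑ q, ‖E s (w q τ) - E s' (w q τ)‖ ^ 2 *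
      ((w q τ).im) ^ (2 : ℤ)) ModularGroup.fd volume := hint
  have hnn : 0 ≤ᵐ[volume.restrict ModularGroup.fd] fun τ : ℍ ↦
      ∑ q, ‖E s (w q τ) - E s' (w q τ)‖ ^ 2 * ((w q τ).im) ^ (2 : ℤ) :=
    ae_of_all _ fun τ ↦ Finset.sum_nonneg fun q _ ↦
      mul_nonneg (sq_nonneg _) (zpow_pos (UpperHalfPlane.im_pos _) _).le
  have hre := peterssonPairing_self_re (N := N) (k := 2) (fun z ↦ E s z - E s' z)
  calc ∫⁻ τ in ModularGroup.fd, D s' τ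
      = ∫⁻ τ in ModularGroup.fd, ENNReal.ofReal
          (∑ q, ‖E s (w q τ) - E s' (w q τ)‖ ^ 2 * ((w q τ).im) ^ (2 : ℤ)) := by
        simp only [hD, if_pos (show 0 < s' ∧ s' ≤ 1 from ⟨hs'0, hs'1⟩)]
    _ = ENNReal.ofReal (∫ τ in ModularGroup.fd,
          ∑ q, ‖E s (w q τ) - E s' (w q τ)‖ ^ 2 * ((w q τ).im) ^ (2 : ℤ)) :=
        (ofReal_integral_eq_lintegral_ofReal hint' hnn).symm
    _ = ENNReal.ofReal
          ((peterssonPairing N 2 (fun z ↦ E s z - E s' z) (fun z ↦ E s z - E s' z)).re) := by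
        rw [hre]
    _ ≤ ENNReal.ofReal ε := ENNReal.ofReal_le_ofReal (hεδ s' hs'0 hs'δ)

/-! ### From the Cauchy property, and from the Gram limit -/

/-- **Hecke's limit in the Petersson norm from the `L²`-Cauchy property.** Let `E s, Q : ℍ → ℂ` be
continuous, the `E s` square-integrable (`0 < s ≤ 1`), `E s → Q` pointwise as `s → 0⁺`, and
`Re⟨E s − E s', E s − E s'⟩ → 0` as `(s, s') → (0⁺, 0⁺)`. Then `Q` is square-integrable and
`Re⟨E s − Q, E s − Q⟩ → 0` (Fatou against the pointwise limit).
[cite: IwaniecKowalski2004, §14.2 (k = 2, Hecke's trick §3.2)] -/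
theorem heckeL2_of_cauchy (E : ℝ → ℍ → ℂ) (Q : ℍ → ℂ)
    (hE : ∀ s : ℝ, 0 < s → s ≤ 1 → Continuous (E s)) (hQ : Continuous Q)
    (hEint : ∀ s : ℝ, 0 < s → s ≤ 1 → PeterssonSqIntegrable N 2 (E s))
    (hlim : ∀ z : ℍ, Tendsto (fun s : ℝ ↦ E s z) (𝓝[>] 0) (𝓝 (Q z)))
    (hcauchy : Tendsto (fun p : ℝ × ℝ ↦
        (peterssonPairing N 2 (fun z ↦ E p.1 z - E p.2 z) (fun z ↦ E p.1 z - E p.2 z)).re)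
      ((𝓝[>] 0) ×ˢ (𝓝[>] 0)) (𝓝 0)) :
    PeterssonSqIntegrable N 2 Q ∧
    Tendsto (fun s : ℝ ↦ (peterssonPairing N 2 (fun z ↦ E s z - Q z) (fun z ↦ E s z - Q z)).re)
      (𝓝[>] 0) (𝓝 0) := by
  letI := Fintype.ofFinite (𝒮ℒ ⧸ (Gamma0 N : Subgroup (GL (Fin 2) ℝ)).subgroupOf 𝒮ℒ)
  set w : (𝒮ℒ ⧸ (Gamma0 N : Subgroup (GL (Fin 2) ℝ)).subgroupOf 𝒮ℒ) → ℍ → ℍ :=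
    fun q τ ↦ (((q.out : 𝒮ℒ) : GL (Fin 2) ℝ)⁻¹ • τ : ℍ) with hw
  -- uniformity: for `ε > 0` there is `δ ∈ (0,1]` with `Re⟨E s − E s', E s − E s'⟩ ≤ ε` on `(0,δ)²`
  have hunif : ∀ ε : ℝ, 0 < ε → ∃ δ : ℝ, 0 < δ ∧ δ ≤ 1 ∧ ∀ s s' : ℝ, 0 < s → s < δ → 0 < s' → s' < δ →
      (peterssonPairing N 2 (fun z ↦ E s z - E s' z) (fun z ↦ E s z - E s' z)).re ≤ ε := by
    intro ε hε
    have hev := hcauchy.eventually (eventually_lt_nhds hε)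
    obtain ⟨i, hi, hsub⟩ := ((nhdsGT_basis (0 : ℝ)).prod_self.eventually_iff).mp hev
    refine ⟨min i 1, lt_min hi one_pos, min_le_right _ _, fun s s' hs hsi hs' hs'i ↦ ?_⟩
    have hmem : (s, s') ∈ Set.Ioo (0 : ℝ) i ×ˢ Set.Ioo (0 : ℝ) i :=
      ⟨⟨hs, lt_of_lt_of_le hsi (min_le_left _ _)⟩, ⟨hs', lt_of_lt_of_le hs'i (min_le_left _ _)⟩⟩
    exact (hsub hmem).le
  -- the Fatou bound for `s ∈ (0, δ)`
  have hbound : ∀ ε : ℝ, 0 < ε → ∃ δ : ℝ, 0 < δ ∧ δ ≤ 1 ∧ ∀ s : ℝ, 0 < s → s < δ →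
      ∫⁻ τ in ModularGroup.fd, ENNReal.ofReal
        (∑ q, ‖E s (w q τ) - Q (w q τ)‖ ^ 2 * ((w q τ).im) ^ (2 : ℤ)) ≤ ENNReal.ofReal ε := by
    intro ε hε
    obtain ⟨δ, hδ, hδ1, hδε⟩ := hunif ε hε
    refine ⟨δ, hδ, hδ1, fun s hs hsδ ↦ ?_⟩
    exact lintegral_sqIntegrand_sub_le_of_cauchy E Q hE hEint hlim hs (hsδ.le.trans hδ1) hδ
      (fun s' hs' hs'δ ↦ hδε s s' hs hsδ hs' hs'δ)
  -- (a): square-integrability of `Q = E s₀ − (E s₀ − Q)`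
  have hnn : ∀ (g : ℍ → ℂ) (τ : ℍ), 0 ≤ ∑ q, ‖g (w q τ)‖ ^ 2 * ((w q τ).im) ^ (2 : ℤ) :=
    fun g τ ↦ Finset.sum_nonneg fun q _ ↦ mul_nonneg (sq_nonneg _) (zpow_pos (UpperHalfPlane.im_pos _) _).le
  have hQint : PeterssonSqIntegrable N 2 Q := by
    obtain ⟨δ, hδ, hδ1, hδb⟩ := hbound 1 one_pos
    set s₀ : ℝ := δ / 2 with hs₀
    have hs₀0 : 0 < s₀ := by positivity
    have hs₀δ : s₀ < δ := by rw [hs₀]; linarith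
    have hs₀1 : s₀ ≤ 1 := by linarith
    have hdiff : PeterssonSqIntegrable N 2 (fun z ↦ E s₀ z - Q z) := by
      unfold PeterssonSqIntegrable
      have hcont := continuous_sqIntegrand (N := N) ((hE s₀ hs₀0 hs₀1).sub hQ)
      refine ⟨hcont.aestronglyMeasurable.restrict, ?_⟩
      rw [hasFiniteIntegral_iff_ofReal (ae_of_all _ fun τ ↦ hnn (fun z ↦ E s₀ z - Q z) τ)]
      exact lt_of_le_of_lt (hδb s₀ hs₀0 hs₀δ) ENNReal.ofReal_lt_top
    have h := peterssonSqIntegrable_sub (E s₀) (fun z ↦ E s₀ z - Q z) (hE s₀ hs₀0 hs₀1).measurable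
      ((hE s₀ hs₀0 hs₀1).measurable.sub hQ.measurable) (hEint s₀ hs₀0 hs₀1) hdiff
    have hfun : (fun z ↦ E s₀ z - (E s₀ z - Q z)) = Q := funext fun z ↦ sub_sub_cancel _ _
    rwa [hfun] at h
  refine ⟨hQint, ?_⟩
  -- (c): `Re⟨E s − Q, E s − Q⟩ = ∫_𝒟 (square-integrand) ≤ ε` for `s ∈ (0, δ)`
  rw [Metric.tendsto_nhds]
  intro ε hε
  obtain ⟨δ, hδ, hδ1, hδb⟩ := hbound (ε / 2) (half_pos hε)
  filter_upwards [Ioo_mem_nhdsGT hδ] with s hs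
  have hs0 : 0 < s := hs.1
  have hs1 : s ≤ 1 := hs.2.le.trans hδ1
  have hdiff : PeterssonSqIntegrable N 2 (fun z ↦ E s z - Q z) :=
    peterssonSqIntegrable_sub _ _ (hE s hs0 hs1).measurable hQ.measurable (hEint s hs0 hs1) hQint
  have hint' : IntegrableOn (fun τ : ℍ ↦ ∑ q, ‖E s (w q τ) - Q (w q τ)‖ ^ 2 *
      ((w q τ).im) ^ (2 : ℤ)) ModularGroup.fd volume := hdiff
  have hre : (peterssonPairing N 2 (fun z ↦ E s z - Q z) (fun z ↦ E s z - Q z)).re =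
      ∫ τ in ModularGroup.fd, ∑ q, ‖E s (w q τ) - Q (w q τ)‖ ^ 2 * ((w q τ).im) ^ (2 : ℤ) :=
    peterssonPairing_self_re _
  have hval : (peterssonPairing N 2 (fun z ↦ E s z - Q z) (fun z ↦ E s z - Q z)).re ≤ ε / 2 := by
    rw [hre, integral_eq_lintegral_of_nonneg_ae (ae_of_all _ fun τ ↦ hnn (fun z ↦ E s z - Q z) τ)
      hint'.aestronglyMeasurable]
    have h := hδb s hs0 hs.2
    have hfin : ENNReal.ofReal (ε / 2) ≠ ⊤ := ENNReal.ofReal_ne_top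
    calc (∫⁻ τ in ModularGroup.fd, ENNReal.ofReal
            (∑ q, ‖E s (w q τ) - Q (w q τ)‖ ^ 2 * ((w q τ).im) ^ (2 : ℤ))).toReal
        ≤ (ENNReal.ofReal (ε / 2)).toReal := (ENNReal.toReal_le_toReal (ne_top_of_le_ne_top hfin h) hfin).mpr h
      _ = ε / 2 := ENNReal.toReal_ofReal (half_pos hε).le
  have hnonneg : 0 ≤ (peterssonPairing N 2 (fun z ↦ E s z - Q z) (fun z ↦ E s z - Q z)).re :=
    re_peterssonPairing_self_nonneg _
  rw [Real.dist_eq, sub_zero, abs_of_nonneg hnonneg]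
  linarith

/-- **Hecke's limit in the Petersson norm from the Gram limit** (Selberg's `L²` form of Hecke's
trick): if, in addition to the hypotheses of `heckeL2_of_cauchy` on `E s → Q`, the Gram pairings
`⟨E s, E s'⟩` converge to some `g₀` as `(s, s') → (0⁺, 0⁺)`, then
`‖E s − E s'‖² = ⟨E s,E s⟩ − ⟨E s,E s'⟩ − ⟨E s',E s⟩ + ⟨E s',E s'⟩ → 0`, so `Q` is square-integrable and
`Re⟨E s − Q, E s − Q⟩ → 0`. [cite: IwaniecKowalski2004, §14.2 (k = 2, Hecke's trick §3.2)] -/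
theorem heckeL2_of_gram_limit (E : ℝ → ℍ → ℂ) (Q : ℍ → ℂ)
    (hE : ∀ s : ℝ, 0 < s → s ≤ 1 → Continuous (E s)) (hQ : Continuous Q)
    (hEint : ∀ s : ℝ, 0 < s → s ≤ 1 → PeterssonSqIntegrable N 2 (E s))
    (hlim : ∀ z : ℍ, Tendsto (fun s : ℝ ↦ E s z) (𝓝[>] 0) (𝓝 (Q z)))
    (g₀ : ℂ) (hgram : Tendsto (fun p : ℝ × ℝ ↦ peterssonPairing N 2 (E p.1) (E p.2))
      ((𝓝[>] 0) ×ˢ (𝓝[>] 0)) (𝓝 g₀)) :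
    PeterssonSqIntegrable N 2 Q ∧
    Tendsto (fun s : ℝ ↦ (peterssonPairing N 2 (fun z ↦ E s z - Q z) (fun z ↦ E s z - Q z)).re)
      (𝓝[>] 0) (𝓝 0) := by
  refine heckeL2_of_cauchy E Q hE hQ hEint hlim ?_
  -- the four Gram pairings along `(s,s), (s,s'), (s',s), (s',s')`
  have hre : Tendsto (fun x : ℂ ↦ x.re) (𝓝 g₀) (𝓝 g₀.re) := Complex.continuous_re.tendsto g₀
  have h11 : Tendsto (fun p : ℝ × ℝ ↦ (peterssonPairing N 2 (E p.1) (E p.1)).re)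
      ((𝓝[>] 0) ×ˢ (𝓝[>] 0)) (𝓝 g₀.re) :=
    (hre.comp (hgram.comp (tendsto_fst.prodMk tendsto_fst))).congr fun _ ↦ rfl
  have h12 : Tendsto (fun p : ℝ × ℝ ↦ (peterssonPairing N 2 (E p.1) (E p.2)).re)
      ((𝓝[>] 0) ×ˢ (𝓝[>] 0)) (𝓝 g₀.re) :=
    (hre.comp hgram).congr fun _ ↦ rfl
  have h21 : Tendsto (fun p : ℝ × ℝ ↦ (peterssonPairing N 2 (E p.2) (E p.1)).re)
      ((𝓝[>] 0) ×ˢ (𝓝[>] 0)) (𝓝 g₀.re) :=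
    (hre.comp (hgram.comp (tendsto_snd.prodMk tendsto_fst))).congr fun _ ↦ rfl
  have h22 : Tendsto (fun p : ℝ × ℝ ↦ (peterssonPairing N 2 (E p.2) (E p.2)).re)
      ((𝓝[>] 0) ×ˢ (𝓝[>] 0)) (𝓝 g₀.re) :=
    (hre.comp (hgram.comp (tendsto_snd.prodMk tendsto_snd))).congr fun _ ↦ rfl
  have hsum : Tendsto (fun p : ℝ × ℝ ↦ (peterssonPairing N 2 (E p.1) (E p.1)).re -
      (peterssonPairing N 2 (E p.1) (E p.2)).re - (peterssonPairing N 2 (E p.2) (E p.1)).re +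
      (peterssonPairing N 2 (E p.2) (E p.2)).re) ((𝓝[>] 0) ×ˢ (𝓝[>] 0)) (𝓝 0) := by
    have h := ((h11.sub h12).sub h21).add h22
    rwa [show g₀.re - g₀.re - g₀.re + g₀.re = 0 by ring] at h
  -- `Re⟨E s − E s', E s − E s'⟩` is that combination for `s, s' ∈ (0, 1]`
  have h1 : ∀ᶠ x : ℝ in 𝓝[>] 0, 0 < x ∧ x ≤ 1 := by
    filter_upwards [Ioc_mem_nhdsGT (show (0 : ℝ) < 1 by norm_num)] with x hx using ⟨hx.1, hx.2⟩
  refine hsum.congr' ?_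
  filter_upwards [h1.prod_mk h1] with p hp
  exact (re_peterssonPairing_sub_sub (E p.1) (E p.2) (hE _ hp.1.1 hp.1.2).measurable
    (hE _ hp.2.1 hp.2.2).measurable (hEint _ hp.1.1 hp.1.2) (hEint _ hp.2.1 hp.2.2)).symm

/-! ### The concrete family `E_s = yˢ P_m(·, s)` -/

/-- **`HeckeL2` at `(N, m)` from the Gram limit alone.** For `m ≥ 1` and the Hecke family
`E_s = yˢP_m(·,s)` of level `Γ₀(N)`: continuity (`continuous_rpow_im_mul_poincareHecke`),
square-integrability for every `s > 0` (`peterssonSqIntegrable_rpow_im_mul_poincareHecke`), the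
pointwise Hecke limit `E_s → Q_m = poincareQSeries N m` (`heckeLimit_of_fourierModes heckeFourierModes`,
`yˢ → 1`) and the continuity of `Q_m` (`mdifferentiable_poincareQSeries`) are theorems of the tree, so
the Gram limit `⟨E_s, E_{s'}⟩ → g₀` as `(s,s') → (0⁺,0⁺)` yields the three conjuncts of `HeckeL2`:
`Q_m` square-integrable, every `E_s` square-integrable, `Re⟨E_s − Q_m, E_s − Q_m⟩ → 0`.
[cite: IwaniecKowalski2004, §14.2 (k = 2, Hecke's trick §3.2)] -/
theorem heckeL2_at_of_gram_limit (N : ℕ) [NeZero N] {m : ℕ} (hm : 1 ≤ m) (g₀ : ℂ)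
    (hgram : Tendsto (fun p : ℝ × ℝ ↦ peterssonPairing N 2
        (fun z : ℍ ↦ ((z.im ^ p.1 : ℝ) : ℂ) * poincareHecke N m p.1 z)
        (fun z : ℍ ↦ ((z.im ^ p.2 : ℝ) : ℂ) * poincareHecke N m p.2 z))
      ((𝓝[>] 0) ×ˢ (𝓝[>] 0)) (𝓝 g₀)) :
    PeterssonSqIntegrable N 2 (poincareQSeries N m) ∧
    (∀ s : ℝ, 0 < s →
      PeterssonSqIntegrable N 2 (fun z : ℍ ↦ ((z.im ^ s : ℝ) : ℂ) * poincareHecke N m s z)) ∧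
    Tendsto (fun s : ℝ ↦ (peterssonPairing N 2
        (fun z : ℍ ↦ ((z.im ^ s : ℝ) : ℂ) * poincareHecke N m s z - poincareQSeries N m z)
        (fun z : ℍ ↦ ((z.im ^ s : ℝ) : ℂ) * poincareHecke N m s z - poincareQSeries N m z)).re)
      (𝓝[>] 0) (𝓝 0) := by
  have hsq : ∀ s : ℝ, 0 < s →
      PeterssonSqIntegrable N 2 (fun z : ℍ ↦ ((z.im ^ s : ℝ) : ℂ) * poincareHecke N m s z) :=
    fun s hs ↦ peterssonSqIntegrable_rpow_im_mul_poincareHecke N m hm s hs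
  have hlim := heckeLimit_of_fourierModes heckeFourierModes N m hm
  have hQ : Continuous (poincareQSeries N m) := (mdifferentiable_poincareQSeries N hm).continuous
  -- `yˢ P_m(z,s) → Q(z)` (since `yˢ → 1`)
  have hlimE : ∀ z : ℍ, Tendsto (fun s : ℝ ↦ ((z.im ^ s : ℝ) : ℂ) * poincareHecke N m s z)
      (𝓝[>] 0) (𝓝 (poincareQSeries N m z)) := by
    intro z
    have hy : Tendsto (fun s : ℝ ↦ ((z.im ^ s : ℝ) : ℂ)) (𝓝[>] 0) (𝓝 1) := by
      have hc : Continuous fun s : ℝ ↦ ((z.im ^ s : ℝ) : ℂ) :=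
        Complex.continuous_ofReal.comp (Real.continuous_const_rpow z.im_pos.ne')
      have h1 : (((z.im ^ (0 : ℝ) : ℝ)) : ℂ) = 1 := by simp
      rw [← h1]
      exact (hc.tendsto 0).mono_left nhdsWithin_le_nhds
    simpa using hy.mul (hlim z)
  obtain ⟨ha, hc⟩ := heckeL2_of_gram_limit (N := N)
    (fun (s : ℝ) (z : ℍ) ↦ ((z.im ^ s : ℝ) : ℂ) * poincareHecke N m s z) (poincareQSeries N m)
    (fun s hs _ ↦ continuous_rpow_im_mul_poincareHecke m hs) hQ (fun s hs _ ↦ hsq s hs) hlimE g₀ hgram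
  exact ⟨ha, hsq, hc⟩

end Literature.NumberTheory.ModularForms.PoincareWeightTwo

end
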